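import Literature.Computability.AlgebraicComplexity.TableauEvalLabelMajorSymm
import HarnessLib

/-!
# Column-major evaluation of tableau highest-weight vectors with CONTENT states (kernel programme)

Topic `Computability/AlgebraicComplexity`; an EXECUTABLE definitions file (kernel-evaluable by
`decide +kernel`, structural recursion only) for the Lean certificate checker of the
multiplicity programmes that evaluate tableau highest-weight vectors at products of linear forms
(cell `val-lit`, Dörfler–Ikenmeyer–Panova's toy model `Ch_4^7`; honest framing of that cell:
kernel replay of a published computer verification at a KNOWN separation; no claim about VP ≠ VNP
or P ≠ NP is made here or there).

`TableauEval.evalC` (`PlethysmTableauEvaluation.lean`) runs over the COLUMNS of a network, keeping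
for every label the WORD of variables its boxes have received so far; the label-major programmes
(`evalA`, `evalT`, `evalTS`, …) run over the LABELS, keeping for every column its unused variables.
This file is the third organisation: over the columns, as `evalC`, but remembering of every label
only the CONTENT (count vector) of its word — by the polarisation identity the symmetric-tensor
entry of a word depends on the word only through its content (`symEntry_eq_S`,
`lookupC_counts_eq_symEntry`), so states with equal contents may be MERGED. This is the dynamic
programme of [DorflerIkenmeyerPanova2020, §5, after "we observe that" (arXiv p. 13): "the
polynomial … only depends on the content vectors"], run against a content table. It is the
programme of choice at SPARSE points (few monomials): a label whose partial content is no longer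
dominated by the componentwise bound `cap` of the table's support can never reach a nonzero table
entry, and its state is dropped at once (`bumpAllChk`); at a MONOMIAL point `x^a y^b z^c w^e` every
label's content is confined to the box `≤ (a,b,c,e)` and the layers stay small where the
label-major programmes (whose per-column states do not see contents) do not.

Contents: §1 content states (`incAt`, `bumpAt`, `bumpAll`, checked versions `incChk`, `bumpChk`,
`bumpAllChk`, domination `domLE`); §2 the programme: layers = key-sorted lists of
`(packed key, state, value)`, one column = the signed shifted copies of the layer along the
column's bijections (`colOpts`, `shiftOpt`) merged by a balanced merge adding up equal states
(`mergeM`, `mergePairs`, `mergeAll`), `stepM`, `layersM`, **`evalM`**; the chunking identity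
`layersM_append` / `evalM_eq_finalM_split` for certificate modules that ship intermediate layers;
§3 kernel sanity values (`evalM = evalC` on the toy network; `evalM = evalTS` on a landed
reciprocal certificate of the cell). Correctness `evalM tab cap Nw = evalC P Nw` for networks passing
the structural check and tables passing `checkTable` whose nonzero keys are dominated by `cap`:
companion proofs file `TableauEvalContentDPProofs.lean`. Elementary [folklore] bookkeeping around the
cited formula; no statement about representations is made in this file.

## References
* [DorflerIkenmeyerPanova2020] J. Dörfler, C. Ikenmeyer, G. Panova, *On geometric complexity
  theory: multiplicity obstructions are stronger than occurrence obstructions*, SIAM J. Appl.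
  Algebra Geom. 4 (2020) = arXiv:1901.04576, §5 (the proper-placement formula (5.6) and its
  dynamic programme over content vectors, arXiv p. 13).
-/

namespace Literature.Computability.AlgebraicComplexity

namespace TableauEval

/-! ## §1 Content states -/

/-- Increment entry `i` of a count vector (no-op past the end). [folklore] -/
def incAt : List ℕ → ℕ → List ℕ
  | [], _ => []
  | a :: l, 0 => (a + 1) :: l
  | a :: l, i + 1 => a :: incAt l i

/-- Increment variable `v` of the content of label `u` (no-op past the end). [folklore] -/
def bumpAt : List (List ℕ) → ℕ → ℕ → List (List ℕ)
  | [], _, _ => []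
  | c :: cs, 0, v => incAt c v :: cs
  | c :: cs, u + 1, v => c :: bumpAt cs u v

/-- Record one column bijection on a content state: the boxes labelled `us` (top to bottom)
receive the variables `vs`. The content analogue of `pushAll`. [folklore] -/
def bumpAll : List (List ℕ) → List ℕ → List ℕ → List (List ℕ)
  | st, u :: us, v :: vs => bumpAll (bumpAt st u v) us vs
  | st, _, _ => st

/-- Increment entry `i` of a count vector if the new entry stays `≤ bound`, else `none`
(no-op past the end). [folklore] -/
def incChk (bound : ℕ) : List ℕ → ℕ → Option (List ℕ)
  | [], _ => some []
  | a :: l, 0 => if Nat.ble (a + 1) bound then some ((a + 1) :: l) else none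
  | a :: l, i + 1 => match incChk bound l i with
    | some l' => some (a :: l')
    | none => none

/-- `bumpAt` checked against the bound `cap[v]` of the bumped variable. [folklore] -/
def bumpChk (cap : List ℕ) : List (List ℕ) → ℕ → ℕ → Option (List (List ℕ))
  | [], _, _ => some []
  | c :: cs, 0, v => match incChk (cap.getD v 0) c v with
    | some c' => some (c' :: cs)
    | none => none
  | c :: cs, u + 1, v => match bumpChk cap cs u v with
    | some cs' => some (c :: cs')
    | none => none

/-- `bumpAll` checked box by box: `none` as soon as a bumped entry exceeds its bound in `cap`
(then the label can never reach a content dominated by `cap`, hence never a nonzero table entry);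
otherwise `some (bumpAll st us vs)` (proofs file). [folklore] -/
def bumpAllChk (cap : List ℕ) : List (List ℕ) → List ℕ → List ℕ → Option (List (List ℕ))
  | st, u :: us, v :: vs => match bumpChk cap st u v with
    | some st' => bumpAllChk cap st' us vs
    | none => none
  | st, _, _ => some st

/-- Pointwise domination `c ≤ cap` of count vectors (`false` if `c` is longer than `cap`).
[folklore] -/
def domLE : List ℕ → List ℕ → Bool
  | [], _ => true
  | _ :: _, [] => false
  | a :: l, b :: m => Nat.ble a b && domLE l m

/-! ## §2 The programme -/

section Program

variable {R : Type*} [CommRing R] [DecidableEq R]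

/-- Base of the packed sort key of a content state (entry `(u, v)` is the digit of weight
`keyBase ^ (u·V + v)`); keys only steer the merge, no property of them is ever needed. [folklore] -/
def keyBase : ℕ := 256

/-- Key increment of one column bijection (`us` receive `vs`). [folklore] -/
def keyDelta (V : ℕ) : List ℕ → List ℕ → ℕ
  | u :: us, v :: vs => keyBase ^ (u * V + v) + keyDelta V us vs
  | _, _ => 0

/-- The signed options of a column: parity of the bijection, the variables of its boxes from top
to bottom, and the key increment. [folklore] -/
def colOpts (V : ℕ) (c : Column) : List (Bool × List ℕ × ℕ) :=
  (permsSign c.vars).map fun q => (q.1, q.2, keyDelta V c.labels q.2)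

/-- Merge step: walk the second list past the entries with smaller keys; on an entry with the
same key AND the same state add the two values into one entry (dropped if the sum is zero);
otherwise insert `a` and continue with `rest`. [folklore] -/
def mergeMAux (a : ℕ × List (List ℕ) × R)
    (rest : List (ℕ × List (List ℕ) × R) → List (ℕ × List (List ℕ) × R)) :
    List (ℕ × List (List ℕ) × R) → List (ℕ × List (List ℕ) × R)
  | [] => a :: rest []
  | b :: l₂ =>
    if Nat.blt b.1 a.1 then b :: mergeMAux a rest l₂
    else if a.1 == b.1 && a.2.1 = b.2.1 then
      (if a.2.2 + b.2.2 = 0 then rest l₂ else rest ((a.1, a.2.1, a.2.2 + b.2.2) :: l₂))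
    else a :: rest (b :: l₂)

/-- **Merge two key-sorted layers, adding up the values of equal states.** For ANY two lists the
result carries the same weighted sum `∑ value · g(state)` as the two inputs together (proofs
file); sortedness only makes equal states meet. [folklore] -/
def mergeM : List (ℕ × List (List ℕ) × R) → List (ℕ × List (List ℕ) × R) →
    List (ℕ × List (List ℕ) × R)
  | [] => fun l₂ => l₂
  | a :: l₁ => fun l₂ => mergeMAux a (mergeM l₁) l₂

/-- Merge adjacent pairs of a list of layers. [folklore] -/
def mergePairs : List (List (ℕ × List (List ℕ) × R)) → List (List (ℕ × List (List ℕ) × R))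
  | a :: b :: ls => mergeM a b :: mergePairs ls
  | ls => ls

/-- Balanced merge of a list of layers (depth fuel; with the fuel exhausted, a sequential merge).
[folklore] -/
def mergeAll : ℕ → List (List (ℕ × List (List ℕ) × R)) → List (ℕ × List (List ℕ) × R)
  | 0, Ls => Ls.foldr mergeM []
  | n + 1, Ls => match Ls with
    | [] => []
    | [L] => L
    | L :: L' :: Ls' => mergeAll n (mergePairs (L :: L' :: Ls'))

/-- The signed shifted copy of a layer along one column option: every state is bumped along the
bijection (dead states dropped), its key shifted, its value signed. A shift preserves the key
order. [folklore] -/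
def shiftOpt (cap : List ℕ) (us : List ℕ) (o : Bool × List ℕ × ℕ)
    (L : List (ℕ × List (List ℕ) × R)) : List (ℕ × List (List ℕ) × R) :=
  L.filterMap fun e =>
    match bumpAllChk cap e.2.1 us o.2.1 with
    | some st' => some (e.1 + o.2.2, st', if o.1 then -e.2.2 else e.2.2)
    | none => none

/-- **One column**: the balanced merge of the signed shifted copies of the layer along all the
bijections `boxes of c → vars of c`. [folklore] -/
def stepM (V : ℕ) (cap : List ℕ) (c : Column) (L : List (ℕ × List (List ℕ) × R)) :
    List (ℕ × List (List ℕ) × R) :=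
  mergeAll 8 ((colOpts V c).map fun o => shiftOpt cap c.labels o L)

/-- All columns, left to right. [folklore] -/
def layersM (V : ℕ) (cap : List ℕ) :
    List Column → List (ℕ × List (List ℕ) × R) → List (ℕ × List (List ℕ) × R)
  | [], L => L
  | c :: cs, L => layersM V cap cs (stepM V cap c L)

/-- The initial layer: every label with zero content, value `1`. [folklore] -/
def Network.initLayerM (Nw : Network) : List (ℕ × List (List ℕ) × R) :=
  [(0, List.replicate Nw.nlabels (List.replicate Nw.varBound 0), 1)]

/-- The value of a final layer against a content table: `∑ value · ∏_labels table(content)`.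
[folklore] -/
def finalM (tab : List (List ℕ × R)) (L : List (ℕ × List (List ℕ) × R)) : R :=
  (L.map fun e => e.2.2 * (e.2.1.map (lookupC tab)).prod).sum

/-- **Content-state column-major evaluation of the tableau network `Nw` against the content table
`tab`, pruned by the bound `cap`** — equal to `evalC P Nw` for networks passing the structural
check and tables passing `checkTable` at `P` whose nonzero keys are dominated by `cap` (proofs
file). [folklore] -/
def evalM (tab : List (List ℕ × R)) (cap : List ℕ) (Nw : Network) : R :=
  finalM tab (layersM Nw.varBound cap Nw.cols Nw.initLayerM)

/-- **Chunking**: the layers of a concatenation of column lists are the layers of the second list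
started from the layers of the first — Dörfler–Ikenmeyer–Panova's column-by-column transfer matrix,
split between two columns. [cite: DorflerIkenmeyerPanova2020, §5 (the dynamic programme over content vectors, arXiv p. 13)] -/
theorem layersM_append (V : ℕ) (cap : List ℕ) : ∀ (cs₁ cs₂ : List Column)
    (L : List (ℕ × List (List ℕ) × R)),
    layersM V cap (cs₁ ++ cs₂) L = layersM V cap cs₂ (layersM V cap cs₁ L)
  | [], _, _ => rfl
  | _ :: cs₁, cs₂, _ => layersM_append V cap cs₁ cs₂ _

/-- **`evalM` in chunks**: split the columns after the first `k`; a certificate module checks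
`layersM … (cols.take k) init = L_k` and the rest from the literal `L_k`, one `decide +kernel` each.
[cite: DorflerIkenmeyerPanova2020, §5 (the dynamic programme over content vectors, arXiv p. 13)] -/
theorem evalM_eq_finalM_split (tab : List (List ℕ × R)) (cap : List ℕ) (Nw : Network) (k : ℕ) :
    evalM tab cap Nw = finalM tab (layersM Nw.varBound cap (Nw.cols.drop k)
      (layersM Nw.varBound cap (Nw.cols.take k) Nw.initLayerM)) := by
  rw [← layersM_append, List.take_append_drop]; rfl

end Program

/-! ## §3 Sanity values (kernel) -/

/-- On the toy network `1 1 / 2 2` (labels `0 0 / 1 1`) at `2 x₀ x₁` (content table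
`(1,1) ↦ 2`, bound `(1,1)`): `evalM = evalC = -8`. [folklore] -/
example :
    let P : Point ℤ := ⟨[(1, [[1, 0], [0, 1]]), (1, [[0, 1], [1, 0]])]⟩
    let N : Network := ⟨2, 2, [⟨[0, 1], [0, 1]⟩, ⟨[0, 1], [0, 1]⟩]⟩
    evalM [([1, 1], (2 : ℤ))] [1, 1] N = -8 ∧ evalC P N = -8 := by
  decide +kernel

/-- A cross-check against the column-symmetrised label-major programme on a landed reciprocal
certificate of the cell (`DIP20Prop51Reciprocal47Q02.lean`, row `(10, 10, 7, 1)`, 7 labels × 4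
boxes, point `x · z · (x + 2y - w) · (x - 2y) ∈ Ch_4^4`, bound = componentwise maximum of the
table's keys): `evalM = evalTS = 75497472`. [folklore] -/
example :
    let N : Network := ⟨7, 4, [⟨[0, 1, 2, 3], [3, 4, 5, 6]⟩, ⟨[0, 1, 2], [0, 2, 3]⟩,
      ⟨[0, 1, 2], [0, 2, 3]⟩, ⟨[0, 1, 2], [0, 2, 3]⟩, ⟨[0, 1, 2], [0, 4, 5]⟩, ⟨[0, 1, 2], [1, 5, 6]⟩,
      ⟨[0, 1, 2], [1, 5, 6]⟩, ⟨[0, 1], [1, 2]⟩, ⟨[0, 1], [1, 4]⟩, ⟨[0, 1], [4, 6]⟩]⟩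
    let tab : List (List ℕ × ℤ) :=
      [([1, 1, 1, 1], 2), ([1, 2, 1, 0], -8), ([2, 0, 1, 1], -2), ([3, 0, 1, 0], 6)]
    evalM tab [3, 2, 1, 1] N = 75497472 ∧ evalTS tab N = 75497472 := by
  decide +kernel

end TableauEval

end Literature.Computability.AlgebraicComplexity
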